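import Summits.Ventures.HodgeRepro2.T5SelfDualLatticeDet
import Summits.Ventures.HodgeRepro2.T5GaloisCartanThree

/-!
# «det V has even valuation» = «det V ∈ 𝒪_F^× · N(E^×)» at an inert place (Tier-5 support, N3)

The N3 record states condition (u3) at an inert place as «`V_v` admits a self-dual
`𝔬_{E_v}`-lattice iff `det V_v` has even valuation» (route-2, N3 v0.15 §N3.10.3, after MVW LNM 1291
Ch. 5 Remarque (2)(c)). `T5SelfDualLatticeDet` proved the lattice half with the criterion
`det H ∈ R₀ˣ · N_{E/F}(E^×)`. This file proves that at an inert place — `R₀` a DVR with uniformiser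
`ϖ`, `E/F` quadratic with `𝒪_E := integralClosure R₀ E` local and `𝔭 𝒪_E = 𝔭_E` (so `ϖ` stays a
uniformiser of `𝒪_E`) — that criterion IS «even valuation»:

  `x ∈ R₀ˣ · N(E^×)  ⟺  x = a · ϖ^(2m)` for some `a ∈ R₀ˣ`, `m ∈ ℤ`,

because every `y ∈ E^×` is `w · ϖ^k` with `w ∈ 𝒪_E^×` (`exists_isInteger_unit_mul_zpow`), the norm
of a unit of `𝒪_E` is a unit of `R₀` (`exists_unit_eq_norm_of_isInteger` — it is a `σ`-fixed unit of
`𝒪_E`, hence in `R₀ˣ` by `T5SelfDualLatticeDet.exists_algebraMap_unit_eq_of_star_eq_of_isInteger`),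
and `N(ϖ^k) = ϖ^(2k)` (`norm_zpow_uniformiser`). Corollary
`exists_dualLattice_eq_iff_exists_det_eq_mul_zpow_quadratic`: **the record's (u3) verbatim —
`V = (E³, H)` admits a self-dual `𝒪_E`-lattice iff `det H = a · ϖ^(2m)`, i.e. iff `det H` has
even valuation.** No L-value anywhere (README §8(d): NO).
-/

namespace Summit.Ventures.HodgeRepro2.T5EvenValuationNorm

open T5UnitaryGroupIsometry T5HermitianThreeElements T5SelfDualLatticeDet

section Fixed

variable {R₀ F E : Type*} [CommRing R₀] [Field F] [Field E] [Algebra R₀ F] [Algebra F E]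
  [Algebra R₀ E] [IsScalarTower R₀ F E]

/-- An `F`-automorphism of `E` fixes the image of `R₀`. -/
theorem algEquiv_algebraMap (σ : E ≃ₐ[F] E) (r : R₀) : σ (algebraMap R₀ E r) = algebraMap R₀ E r := by
  rw [IsScalarTower.algebraMap_apply R₀ F E, AlgEquiv.commutes]

end Fixed

section Inert

variable {R₀ F E : Type*} [CommRing R₀] [IsDomain R₀] [IsDiscreteValuationRing R₀] [Field F]
  [Field E] [Algebra R₀ F] [IsFractionRing R₀ F] [Algebra F E] [Algebra R₀ E]
  [IsScalarTower R₀ F E] [FiniteDimensional F E] [Algebra.IsSeparable F E]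
  [IsLocalRing (integralClosure R₀ E)]

omit [IsDomain R₀] [IsDiscreteValuationRing R₀] [FiniteDimensional F E] [Algebra.IsSeparable F E]
  [IsLocalRing (integralClosure R₀ E)] in
include F in
/-- The uniformiser of `R₀`, read in `E`, is non-zero. -/
theorem algebraMap_uniformiser_ne_zero {ϖ : R₀} (hϖ : Irreducible ϖ) : algebraMap R₀ E ϖ ≠ 0 := by
  rw [map_ne_zero_iff _ (algebraMap_injective' (F := F) (E := E))]
  exact hϖ.ne_zero

include F in
/-- Every non-zero `y ∈ E` is `w · ϖ^k` with `w` a unit of `𝒪_E` (`w`, `w⁻¹` integral) and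
`k ∈ ℤ`, `ϖ` a uniformiser of `R₀` that stays irreducible in `𝒪_E` (`𝔭 𝒪_E = 𝔭_E`). -/
theorem exists_isInteger_unit_mul_zpow
    (hunr : Ideal.map (algebraMap R₀ (integralClosure R₀ E)) (IsLocalRing.maximalIdeal R₀) =
      IsLocalRing.maximalIdeal (integralClosure R₀ E))
    {ϖ : R₀} (hϖ : Irreducible ϖ) {y : E} (hy : y ≠ 0) :
    ∃ (w : E) (k : ℤ), IsLocalization.IsInteger (integralClosure R₀ E) w ∧
      IsLocalization.IsInteger (integralClosure R₀ E) w⁻¹ ∧ y = w * algebraMap R₀ E ϖ ^ k := by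
  haveI : IsDiscreteValuationRing (integralClosure R₀ E) :=
    T5UnramifiedUniformiser.isDiscreteValuationRing_integralClosure R₀ F E
  haveI : IsFractionRing (integralClosure R₀ E) E :=
    integralClosure.isFractionRing_of_finite_extension F E
  have hϖ' : Irreducible (algebraMap R₀ (integralClosure R₀ E) ϖ) :=
    T5GaloisCartanThree.irreducible_uniformiser hunr hϖ
  obtain ⟨c, d, hd, hcd⟩ := IsFractionRing.div_surjective (integralClosure R₀ E) y
  have hd0 : d ≠ 0 := nonZeroDivisors.ne_zero hd
  have hc0 : c ≠ 0 := by
    rintro rfl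
    apply hy
    rw [← hcd, map_zero, zero_div]
  obtain ⟨n₁, u₁, hc⟩ := IsDiscreteValuationRing.eq_unit_mul_pow_irreducible hc0 hϖ'
  obtain ⟨n₂, u₂, hd'⟩ := IsDiscreteValuationRing.eq_unit_mul_pow_irreducible hd0 hϖ'
  have hϖE : algebraMap (integralClosure R₀ E) E (algebraMap R₀ (integralClosure R₀ E) ϖ) =
      algebraMap R₀ E ϖ := (IsScalarTower.algebraMap_apply R₀ (integralClosure R₀ E) E ϖ).symm
  have hϖ0 : algebraMap R₀ E ϖ ≠ 0 := algebraMap_uniformiser_ne_zero (F := F) hϖ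
  have hu₁ : algebraMap (integralClosure R₀ E) E (u₁ : integralClosure R₀ E) ≠ 0 :=
    (map_ne_zero_iff _ (IsFractionRing.injective _ _)).mpr u₁.ne_zero
  have hu₂ : algebraMap (integralClosure R₀ E) E (u₂ : integralClosure R₀ E) ≠ 0 :=
    (map_ne_zero_iff _ (IsFractionRing.injective _ _)).mpr u₂.ne_zero
  refine ⟨algebraMap (integralClosure R₀ E) E ((u₁ * u₂⁻¹ : (integralClosure R₀ E)ˣ) :
    integralClosure R₀ E), (n₁ : ℤ) - n₂, ⟨_, rfl⟩, ?_, ?_⟩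
  · refine ⟨((u₁ * u₂⁻¹)⁻¹ : (integralClosure R₀ E)ˣ), ?_⟩
    rw [map_units_inv]
  · rw [← hcd, hc, hd', map_mul, map_mul, map_pow, map_pow, hϖE, Units.val_mul, map_mul,
      map_units_inv, zpow_sub₀ hϖ0, zpow_natCast, zpow_natCast]
    field_simp

omit [Algebra.IsSeparable F E] [IsLocalRing (integralClosure R₀ E)] in
/-- The norm `σ w · w` of a unit `w` of `𝒪_E` is a unit of `R₀` (`σ` the Galois conjugation of a
quadratic extension). -/
theorem exists_unit_eq_norm_of_isInteger (h2 : Module.finrank F E = 2) (σ : E ≃ₐ[F] E)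
    (hσ : σ ≠ 1) {w : E} (hw : w ≠ 0) (hwi : IsLocalization.IsInteger (integralClosure R₀ E) w)
    (hwi' : IsLocalization.IsInteger (integralClosure R₀ E) w⁻¹) :
    ∃ b : R₀ˣ, algebraMap R₀ E b = σ w * w := by
  letI := T5StarOfInvolution.starRingOfQuadratic h2 σ hσ
  have hτ := T5QuadraticAutomorphism.apply_apply h2 σ hσ
  have hstar : ∀ z : E, star z = σ z := fun z => T5StarOfInvolution.star_eq σ.toRingEquiv hτ z
  have hfix : star (σ w * w) = σ w * w := by
    rw [hstar, map_mul, hτ, mul_comm]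
  have hint : IsLocalization.IsInteger (integralClosure R₀ E) (σ w * w) :=
    IsLocalization.isInteger_mul (by rw [← hstar]; exact
      T5StarOfInvolution.isInteger_integralClosure_star σ hτ w hwi) hwi
  have hint' : IsLocalization.IsInteger (integralClosure R₀ E) (σ w * w)⁻¹ := by
    rw [mul_inv, ← map_inv₀]
    exact IsLocalization.isInteger_mul (by rw [← hstar]; exact
      T5StarOfInvolution.isInteger_integralClosure_star σ hτ _ hwi') hwi'
  have hne : σ w * w ≠ 0 := mul_ne_zero ((map_ne_zero_iff _ σ.injective).mpr hw) hw
  exact exists_algebraMap_unit_eq_of_star_eq_of_isInteger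
    (fun z hz => (T5StarOfInvolution.star_eq_self_iff_mem_range h2 σ hσ z).mp hz) hfix hne hint hint'

omit [IsDomain R₀] [IsDiscreteValuationRing R₀] [FiniteDimensional F E] [Algebra.IsSeparable F E]
  [IsLocalRing (integralClosure R₀ E)] in
/-- `N(ϖ^k) = ϖ^(2k)`. -/
theorem norm_zpow_uniformiser (σ : E ≃ₐ[F] E) {ϖ : R₀} (hϖ : Irreducible ϖ) (k : ℤ) :
    σ (algebraMap R₀ E ϖ ^ k) * algebraMap R₀ E ϖ ^ k = algebraMap R₀ E ϖ ^ (2 * k) := by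
  rw [map_zpow₀, algEquiv_algebraMap, two_mul, zpow_add₀ (algebraMap_uniformiser_ne_zero (F := F) hϖ)]

/-- **At an inert place, `R₀ˣ · N(E^×)` is the set of elements of even valuation**: `x ∈ E` is a
unit of `R₀` times a norm `σ y · y` iff `x = a · ϖ^(2m)` with `a ∈ R₀ˣ`, `m ∈ ℤ`. -/
theorem exists_unit_mul_norm_iff_exists_unit_mul_zpow_even (h2 : Module.finrank F E = 2)
    (σ : E ≃ₐ[F] E) (hσ : σ ≠ 1)
    (hunr : Ideal.map (algebraMap R₀ (integralClosure R₀ E)) (IsLocalRing.maximalIdeal R₀) =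
      IsLocalRing.maximalIdeal (integralClosure R₀ E))
    {ϖ : R₀} (hϖ : Irreducible ϖ) (x : E) :
    (∃ (a : R₀ˣ) (y : E), y ≠ 0 ∧ x = algebraMap R₀ E a * (σ y * y)) ↔
      ∃ (a : R₀ˣ) (m : ℤ), x = algebraMap R₀ E a * algebraMap R₀ E ϖ ^ (2 * m) := by
  constructor
  · rintro ⟨a, y, hy, rfl⟩
    obtain ⟨w, k, hw, hw', rfl⟩ := exists_isInteger_unit_mul_zpow (F := F) hunr hϖ hy
    have hw0 : w ≠ 0 := by
      rintro rfl
      exact hy (zero_mul _)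
    obtain ⟨b, hb⟩ := exists_unit_eq_norm_of_isInteger h2 σ hσ hw0 hw hw'
    refine ⟨a * b, k, ?_⟩
    rw [Units.val_mul, (algebraMap R₀ E).map_mul, hb, ← norm_zpow_uniformiser σ hϖ k,
      map_mul σ w]
    ring
  · rintro ⟨a, m, rfl⟩
    refine ⟨a, algebraMap R₀ E ϖ ^ m, zpow_ne_zero m (algebraMap_uniformiser_ne_zero (F := F) hϖ), ?_⟩
    rw [norm_zpow_uniformiser σ hϖ m]

/-- **(u3) verbatim.** At an inert place (`R₀` a DVR with uniformiser `ϖ`, `E/F` quadratic with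
Galois conjugation `σ`, `𝒪_E` local with `𝔭 𝒪_E = 𝔭_E`), for `H` hermitian `3 × 3` with unit
determinant, `2 ≠ 0` and an isotropic vector: `V = (E³, H)` admits a self-dual `𝒪_E`-lattice iff
`det H = a · ϖ^(2m)` for some `a ∈ R₀ˣ`, `m ∈ ℤ` — iff `det H` has even valuation. -/
theorem exists_dualLattice_eq_iff_exists_det_eq_mul_zpow_quadratic (h2 : Module.finrank F E = 2)
    (σ : E ≃ₐ[F] E) (hσ : σ ≠ 1)
    (hunr : Ideal.map (algebraMap R₀ (integralClosure R₀ E)) (IsLocalRing.maximalIdeal R₀) =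
      IsLocalRing.maximalIdeal (integralClosure R₀ E))
    {ϖ : R₀} (hϖ : Irreducible ϖ) {H : Matrix (Fin 3) (Fin 3) E}
    (hH : letI := T5StarOfInvolution.starRingOfQuadratic h2 σ hσ; H.IsHermitian)
    (hdet : IsUnit H.det) (htwo : (2 : E) ≠ 0) {e : Fin 3 → E} (he : e ≠ 0)
    (he0 : letI := T5StarOfInvolution.starRingOfQuadratic h2 σ hσ; sesqForm H e e = 0) :
    letI := T5StarOfInvolution.starRingOfQuadratic h2 σ hσ
    (∃ Q : Matrix (Fin 3) (Fin 3) E, IsUnit Q ∧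
        dualLattice (integralClosure R₀ E) (Q.conjTranspose * H * Q)
          (stdLattice (integralClosure R₀ E)) = stdLattice (integralClosure R₀ E)) ↔
      ∃ (a : R₀ˣ) (m : ℤ), H.det = algebraMap R₀ E a * algebraMap R₀ E ϖ ^ (2 * m) := by
  rw [exists_dualLattice_eq_iff_det_eq_mul_norm_quadratic h2 σ hσ hH hdet htwo he he0]
  exact exists_unit_mul_norm_iff_exists_unit_mul_zpow_even h2 σ hσ hunr hϖ H.det

end Inert

end Summit.Ventures.HodgeRepro2.T5EvenValuationNorm
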